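import Summits.ResolutionOfSingularities.ResolutionOfSingularities.Theorems.PurelyInseparableDim4ResConeCornerTransfer
import Summits.ResolutionOfSingularities.ResolutionOfSingularities.Theorems.PurelyInseparableDim4ResConeAlternation
import HarnessLib
import HarnessLib.Audit.Tags

/-!
# Purely inseparable four-folds — NO BINARY-CONE TAIL ON A PERMANENT LIGHT BOUNDARY PAIR: the class-level form of
# idea-4's T43e2 for every prime and every tame residual degree — all frame data derived from the walk itself
# (K2(p) lane, SLICE C (C8), file-holder res-dim4-p-5 g3)

[OURS · counted 0 · cell `res-dim4-pi` · K2(p) lane (desk WORDS #78 (d), #80 (d), #96 (b)) · seat res-dim4-p-5 g3.]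
Nothing here proves K2(p), `NoIsolatedTrap p p` or resolution of singularities in dimension ≥ 4 /
characteristic `p`.

THE THEOREM (`no_binary_pair_tail`).  Over any field of characteristic `p` there is no isolated above-floor
witnessed `Step0 p` chain with `x^{r₀} ∣ F₀` which, from some `k₀` on, has constant natural shade `d < p`,
`e_G ≡ 2` (binary cones), chart letters in a pair `{a, a′}`, the two letters PERMANENT boundary letters
(`r_k(a), r_k(a′) ≥ 1`), the two other letters FREE (`r = 0`, not exceptional), and LIGHT letters
(`r_k(a) + r_k(a′) ≤ 2 r_{k+1}(j k)`).  (idea-4's class C∞ at `p = 5`, `d = 4`, `r ≡ (1,1)` is the model; here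
`p` and `d < p` are arbitrary.)

Everything the transfer theorem `…CornerTransfer.no_tilt_at_letter_change` asks for is DERIVED:
* `free_translation_of_pair` — permanence of `a, a′` forbids translating them (`…CornerRigidTail.step_r_apply_eq_zero_of_ne`),
  the other letters carry no boundary: translations are free;
* **`no_passive_kernel_vector`** — a kernel vector with vanishing `a`- and `a′`-coordinates would persist for ever
  ((I2), `…Alternation.chain_resVertex_step_inf_hyperplane_eq`) and forbid every later SATELLITE step
  ((SAT-PREDICTED), `…SatChain.chain_satellite_direction_eq_smul`: the satellite direction would be a multiple of it,
  yet has a chart coordinate `1`) — but satellites recur (`FreeTailProof.noIsolatedFreeTailAt_self`); so the polar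
  kernel projects isomorphically onto `⟨e_a, e_{a′}⟩` and its tilts `α, γ` live on the two free letters;
* a letter change exists (FT again), `a′ → a` or `a → a′` — the statement is symmetric in the pair.
[cite: CossartJannsenSaito2020, Thm. 3.10(4), Thm. 3.14, Lemma 13.2, Lemma 13.4, Thm. 13.7]
bears_on: LADDER-RESOLUTION:D157-DOOR2 (res-dim4-pi · K2(p) = `RidgeBudget.NoAboveFloorTrap p p` · slice C).
Supports stmt-ResolutionOfSingularities-16155 (helper).
-/

set_option linter.dupNamespace false -- mandated namespace of this single-conjunct summit

noncomputable section

namespace Summit.ResolutionOfSingularities.ResolutionOfSingularities.Theorems.PIDim4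

namespace ResCone

open MvPolynomial Finset
open Literature.AlgebraicGeometry.Resolution
open Literature.AlgebraicGeometry.Resolution.CentreBlowup
open Literature.AlgebraicGeometry.Resolution.Hauser2010
open Literature.AlgebraicGeometry.Resolution.HauserPerlega2019
open PointBlowup (polarMap additiveSubspace direction)

variable {K : Type} [Field K]

section Pair

variable (p : ℕ) [Fact p.Prime] [CharP K p] [DecidableEq K]

omit [CharP K p] in
/-- **Free translations on a permanent pair**: if `a, a′` stay boundary letters and the other letters are free,
no step of the tail translates a boundary letter. [OURS] [cite: HauserPerlega2019PRIMS, §2] -/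
theorem free_translation_of_pair {c : ℕ → State K} {j : ℕ → Fin 4} {b : ℕ → Fin 4 → K}
    (hc : ∀ k, IsIsolated p (c k).F ∧ Step0 p (c k) (c (k + 1))) (hw : FreeTail.IsWitnessedChain p c j b)
    (hr0 : ∀ e ∈ (c 0).F.support, (c 0).r ≤ e) (hfloor : ∀ k, ordZero (c k).F ≠ p) {k₀ : ℕ} {a a' : Fin 4}
    (hbdry : ∀ k, k₀ ≤ k → 1 ≤ (c k).r a ∧ 1 ≤ (c k).r a')
    (hpass : ∀ k, k₀ ≤ k → ∀ i, i ≠ a → i ≠ a' → (c k).r i = 0 ∧ i ∉ (c k).exc) :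
    ∀ k, k₀ ≤ k → ∀ i, b k i ≠ 0 → (c k).r i = 0 := by
  intro k hk i hbi
  by_cases hia : i = a
  · exfalso
    subst hia
    have hij : i ≠ j k := fun h => hbi (by rw [h]; exact (hw k).2.1)
    obtain ⟨o, ho, -, -⟩ := chain_band p hc hfloor k
    have h0 := step_r_apply_eq_zero_of_ne p (j k) (hw k).2.1 (c k) ho (IsolatedBand.isolated_chain_forall_le hc hr0 k)
      hij hbi
    rw [← (hw k).2.2.2.2] at h0
    have := (hbdry (k + 1) (by omega)).1
    omega
  · by_cases hia' : i = a'
    · exfalso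
      subst hia'
      have hij : i ≠ j k := fun h => hbi (by rw [h]; exact (hw k).2.1)
      obtain ⟨o, ho, -, -⟩ := chain_band p hc hfloor k
      have h0 := step_r_apply_eq_zero_of_ne p (j k) (hw k).2.1 (c k) ho
        (IsolatedBand.isolated_chain_forall_le hc hr0 k) hij hbi
      rw [← (hw k).2.2.2.2] at h0
      have := (hbdry (k + 1) (by omega)).2
      omega
    · exact (hpass k hk i hia hia').1

/-- **NO PASSIVE KERNEL VECTOR** on a constant-`(d, e_G = 2)` tail with chart letters in `{a, a′}`: a vector of the
polar kernel with vanishing `a`- and `a′`-coordinates is zero.  (It would persist by (I2) and make every later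
satellite direction a multiple of itself, (SAT-PREDICTED); satellites recur by FT.) [OURS]
[cite: CossartJannsenSaito2020, Thm. 3.10(4), Thm. 3.14] -/
theorem no_passive_kernel_vector {c : ℕ → State K} {j : ℕ → Fin 4} {b : ℕ → Fin 4 → K}
    (hc : ∀ k, IsIsolated p (c k).F ∧ Step0 p (c k) (c (k + 1))) (hw : FreeTail.IsWitnessedChain p c j b)
    (hr0 : ∀ e ∈ (c 0).F.support, (c 0).r ≤ e) (hfloor : ∀ k, ordZero (c k).F ≠ p) {k₀ : ℕ} {d : ℕ∞}
    (hshade : ∀ k, k₀ ≤ k → (c k).shade = d) (he : ∀ k, k₀ ≤ k → Module.finrank K (resVertex (c k)) = 2)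
    {a a' : Fin 4} (hletters : ∀ k, k₀ ≤ k → (j k = a ∨ j k = a')) {k : ℕ} (hk : k₀ ≤ k) {w : Fin 4 → K}
    (hwV : w ∈ resVertex (c k)) (hwa : w a = 0) (hwa' : w a' = 0) : w = 0 := by
  by_contra hw0
  have hwj : ∀ n, k₀ ≤ n → w (j n) = 0 := fun n hn => by
    rcases hletters n hn with h | h <;> rw [h]
    · exact hwa
    · exact hwa'
  -- the vector persists
  have hpers : ∀ n, w ∈ resVertex (c (k + n)) := by
    intro n
    induction n with
    | zero => simpa using hwV
    | succ n ih =>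
      have hI2 := chain_resVertex_step_inf_hyperplane_eq p hc hw hr0 hfloor hshade he (k := k + n) (by omega)
      have hmem : w ∈ resVertex (c (k + n)) ⊓ hyperplane (j (k + n)) :=
        Submodule.mem_inf.mpr ⟨ih, mem_hyperplane.mpr (hwj (k + n) (by omega))⟩
      rw [← hI2, show k + n + 1 = k + (n + 1) by ring] at hmem
      exact (Submodule.mem_inf.mp hmem).1
  -- a satellite step occurs after `k`
  have hsat : ∃ n, k ≤ n ∧ FreeTail.IsSatellite j b n := by
    by_contra h
    push Not at h
    obtain ⟨m, hm⟩ := FreeTailProof.noIsolatedFreeTailAt_self p K c j b k hw h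
    exact hm (hc m).1
  obtain ⟨n, hkn, hsatn⟩ := hsat
  obtain ⟨i, rfl⟩ : ∃ i, n = k + i := ⟨n - k, by omega⟩
  have h := chain_satellite_direction_eq_smul p hc hw hr0 hfloor hshade (k := k + i) (by omega) hsatn
    (by rw [he (k + i) (by omega)]) (hpers i) (hwj (k + i) (by omega)) hw0
  exact h.1 (hwj (k + i + 1) (by omega))

/-- The two letters outside a pair. [folklore] -/
theorem exists_pair_compl {a a' : Fin 4} (haa : a ≠ a') :
    ∃ f₁ f₂ : Fin 4, f₁ ≠ f₂ ∧ f₁ ≠ a ∧ f₁ ≠ a' ∧ f₂ ≠ a ∧ f₂ ≠ a' ∧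
      ∀ i : Fin 4, i ≠ f₁ → i ≠ f₂ → (i = a ∨ i = a') := by
  have hcard : ((Finset.univ.erase a).erase a').card = 2 := by
    rw [Finset.card_erase_of_mem (Finset.mem_erase.mpr ⟨haa.symm, Finset.mem_univ a'⟩),
      Finset.card_erase_of_mem (Finset.mem_univ a), Finset.card_univ, Fintype.card_fin]
  obtain ⟨f₁, f₂, hne, heq⟩ := Finset.card_eq_two.mp hcard
  have hf₁ : f₁ ∈ (Finset.univ.erase a).erase a' := by rw [heq]; simp
  have hf₂ : f₂ ∈ (Finset.univ.erase a).erase a' := by rw [heq]; simp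
  refine ⟨f₁, f₂, hne, Finset.ne_of_mem_erase (Finset.mem_of_mem_erase hf₁), Finset.ne_of_mem_erase hf₁,
    Finset.ne_of_mem_erase (Finset.mem_of_mem_erase hf₂), Finset.ne_of_mem_erase hf₂, fun i hi₁ hi₂ => ?_⟩
  by_contra h
  push Not at h
  have hi : i ∈ (Finset.univ.erase a).erase a' :=
    Finset.mem_erase.mpr ⟨h.2, Finset.mem_erase.mpr ⟨h.1, Finset.mem_univ i⟩⟩
  rw [heq, Finset.mem_insert, Finset.mem_singleton] at hi
  rcases hi with hi | hi
  · exact hi₁ hi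
  · exact hi₂ hi

/-- The class-level theorem at a given letter change `a′ → a`. [OURS]
[cite: CossartJannsenSaito2020, Thm. 3.10(4), Thm. 3.14, Lemma 13.2, Lemma 13.4, Thm. 13.7] -/
theorem no_binary_pair_tail_at {c : ℕ → State K} {j : ℕ → Fin 4} {b : ℕ → Fin 4 → K}
    (hc : ∀ k, IsIsolated p (c k).F ∧ Step0 p (c k) (c (k + 1))) (hw : FreeTail.IsWitnessedChain p c j b)
    (hr0 : ∀ e ∈ (c 0).F.support, (c 0).r ≤ e) (hfloor : ∀ k, ordZero (c k).F ≠ p) {k₀ d : ℕ} (hdp : d < p)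
    (hshade : ∀ k, k₀ ≤ k → (c k).shade = (d : ℕ∞)) {a a' : Fin 4} (haa : a ≠ a')
    (hletters : ∀ k, k₀ ≤ k → (j k = a ∨ j k = a'))
    (he : ∀ k, k₀ ≤ k → Module.finrank K (resVertex (c k)) = 2)
    (hbdry : ∀ k, k₀ ≤ k → 1 ≤ (c k).r a ∧ 1 ≤ (c k).r a')
    (hpass : ∀ k, k₀ ≤ k → ∀ i, i ≠ a → i ≠ a' → (c k).r i = 0 ∧ i ∉ (c k).exc)
    (hlight : ∀ k, k₀ ≤ k → (c k).r a + (c k).r a' ≤ 2 * (c (k + 1)).r (j k))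
    {k₁ : ℕ} (hk₁ : k₀ ≤ k₁) (hj₁ : j k₁ = a') (hj₂ : j (k₁ + 1) = a) : False := by
  have hfreeT := free_translation_of_pair p hc hw hr0 hfloor hbdry hpass
  obtain ⟨f₁, f₂, hf₁₂, hf₁a, hf₁a', hf₂a, hf₂a', hcompl⟩ := exists_pair_compl haa
  set m := k₁ + 1 with hm
  -- `α`: the direction of the `a`-step `m` is `e_a + b m`, with `b m` passive
  have hv : direction (j m) (b m) ∈ resVertex (c m) :=
    chain_direction_mem_resVertex p hc hw hr0 hfloor hshade (by omega)
  have hbma : b m a = 0 := by rw [← hj₂]; exact (hw m).2.1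
  have hbma' : b m a' = 0 := by
    by_contra h
    have := hfreeT m (by omega) a' h
    have := (hbdry m (by omega)).2
    omega
  have hdir : direction (j m) (b m) = Pi.single a 1 + b m := by
    funext i
    rw [hj₂]
    by_cases hia : i = a
    · rw [hia, direction_apply_self, Pi.add_apply, Pi.single_eq_same, hbma, add_zero]
    · rw [direction_apply_of_ne hia, Pi.add_apply, Pi.single_eq_of_ne hia, zero_add]
  have hαs : ∀ i, i ≠ f₁ → i ≠ f₂ → b m i = 0 := fun i hi₁ hi₂ => by
    rcases hcompl i hi₁ hi₂ with rfl | rfl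
    · exact hbma
    · exact hbma'
  -- `γ`: a generator of the line `resVertex (c m) ⊓ H_a`, normalised at `a′`
  obtain ⟨o, ho, hpo, ho2⟩ := chain_band p hc hfloor m
  have hrm := IsolatedBand.isolated_chain_forall_le hc hr0 m
  have heqsh : (CentreBlowup.step p Finset.univ (j m) (b m) (c m)).shade = (c m).shade :=
    chain_shade_step p hw hshade (k := m) (by omega)
  have hline : Module.finrank K ↥(resVertex (c m) ⊓ hyperplane a) = 1 := by
    have h := finrank_resVertex_inf_hyperplane_add_one (j m) (hw m).2.1 ho hrm hpo ho2 heqsh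
    rw [hj₂, he m (by omega)] at h
    omega
  obtain ⟨π, hπ, hπ0⟩ : ∃ π ∈ resVertex (c m) ⊓ hyperplane a, π ≠ 0 := by
    by_contra h
    push Not at h
    have hbot : resVertex (c m) ⊓ hyperplane a = ⊥ := by
      rw [Submodule.eq_bot_iff]; exact h
    rw [hbot, finrank_bot] at hline
    exact zero_ne_one hline
  have hπV : π ∈ resVertex (c m) := (Submodule.mem_inf.mp hπ).1
  have hπa : π a = 0 := mem_hyperplane.mp (Submodule.mem_inf.mp hπ).2
  have hπa' : π a' ≠ 0 := fun h0 =>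
    hπ0 (no_passive_kernel_vector p hc hw hr0 hfloor hshade he hletters (k := m) (by omega) hπV hπa h0)
  set γ : Fin 4 → K := (π a')⁻¹ • π - Pi.single a' 1 with hγ
  have hγV : Pi.single a' 1 + γ ∈ resVertex (c m) := by
    have : Pi.single a' 1 + γ = (π a')⁻¹ • π := by rw [hγ]; abel
    rw [this]
    exact Submodule.smul_mem _ _ hπV
  have hγa : γ a = 0 := by
    simp only [hγ, Pi.sub_apply, Pi.smul_apply, smul_eq_mul, hπa, mul_zero, Pi.single_eq_of_ne haa, sub_zero]
  have hγa' : γ a' = 0 := by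
    simp only [hγ, Pi.sub_apply, Pi.smul_apply, smul_eq_mul, inv_mul_cancel₀ hπa', Pi.single_eq_same, sub_self]
  have hγs : ∀ i, i ≠ f₁ → i ≠ f₂ → γ i = 0 := fun i hi₁ hi₂ => by
    rcases hcompl i hi₁ hi₂ with rfl | rfl
    · exact hγa
    · exact hγa'
  -- the transfer theorem
  exact no_tilt_at_letter_change p hc hw hr0 hfloor hdp hshade haa hletters he hbdry hlight hfreeT hk₁ hj₁ hj₂
    hf₁₂ hf₁a hf₁a' hf₂a hf₂a' (hpass m (by omega) f₁ hf₁a hf₁a') (hpass m (by omega) f₂ hf₂a hf₂a') hαs hγs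
    ⟨by rw [← hdir]; exact hv, hγV⟩

/-- **NO BINARY-CONE TAIL ON A PERMANENT LIGHT BOUNDARY PAIR** (every prime `p`, every `d < p`): there is no
isolated above-floor witnessed `Step0 p` chain with `x^{r₀} ∣ F₀` which, from some `k₀` on, has constant natural
shade `d < p`, `e_G ≡ 2`, chart letters in `{a, a′}`, `a, a′` permanent boundary letters, the other two letters free,
and light letters `r_k(a) + r_k(a′) ≤ 2 r_{k+1}(j k)`. [OURS]
[cite: CossartJannsenSaito2020, Thm. 3.10(4), Thm. 3.14, Lemma 13.2, Lemma 13.4, Thm. 13.7] -/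
theorem no_binary_pair_tail {c : ℕ → State K} {j : ℕ → Fin 4} {b : ℕ → Fin 4 → K}
    (hc : ∀ k, IsIsolated p (c k).F ∧ Step0 p (c k) (c (k + 1))) (hw : FreeTail.IsWitnessedChain p c j b)
    (hr0 : ∀ e ∈ (c 0).F.support, (c 0).r ≤ e) (hfloor : ∀ k, ordZero (c k).F ≠ p) {k₀ d : ℕ} (hdp : d < p)
    (hshade : ∀ k, k₀ ≤ k → (c k).shade = (d : ℕ∞)) {a a' : Fin 4} (haa : a ≠ a')
    (hletters : ∀ k, k₀ ≤ k → (j k = a ∨ j k = a'))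
    (he : ∀ k, k₀ ≤ k → Module.finrank K (resVertex (c k)) = 2)
    (hbdry : ∀ k, k₀ ≤ k → 1 ≤ (c k).r a ∧ 1 ≤ (c k).r a')
    (hpass : ∀ k, k₀ ≤ k → ∀ i, i ≠ a → i ≠ a' → (c k).r i = 0 ∧ i ∉ (c k).exc)
    (hlight : ∀ k, k₀ ≤ k → (c k).r a + (c k).r a' ≤ 2 * (c (k + 1)).r (j k)) : False := by
  -- a satellite step after `k₀` is a letter change inside the pair
  have hsat : ∃ n, k₀ ≤ n ∧ FreeTail.IsSatellite j b n := by
    by_contra h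
    push Not at h
    obtain ⟨m, hm⟩ := FreeTailProof.noIsolatedFreeTailAt_self p K c j b k₀ hw h
    exact hm (hc m).1
  obtain ⟨n, hn, hsatn⟩ := hsat
  have hchg : j (n + 1) ≠ j n := hsatn.1
  rcases hletters n hn with hja | hja'
  · -- change `a → a′`: the theorem with the letters swapped
    have hja'2 : j (n + 1) = a' := by
      rcases hletters (n + 1) (by omega) with h | h
      · exact absurd (h.trans hja.symm) hchg
      · exact h
    exact no_binary_pair_tail_at p hc hw hr0 hfloor hdp hshade haa.symm (fun k hk => (hletters k hk).symm)
      he (fun k hk => (hbdry k hk).symm) (fun k hk i hi₁ hi₂ => hpass k hk i hi₂ hi₁)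
      (fun k hk => by rw [add_comm]; exact hlight k hk) hn hja hja'2
  · have hja2 : j (n + 1) = a := by
      rcases hletters (n + 1) (by omega) with h | h
      · exact h
      · exact absurd (h.trans hja'.symm) hchg
    exact no_binary_pair_tail_at p hc hw hr0 hfloor hdp hshade haa hletters he hbdry hpass hlight hn hja' hja2

end Pair

end ResCone

end Summit.ResolutionOfSingularities.ResolutionOfSingularities.Theorems.PIDim4

end
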